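import Summits.FinalStateConjecture.FinalStateConjecture.Theorems.PhaseMixingCaptureCaptureSufficesTameLabelRigidityC0ModelPoint
import Summits.FinalStateConjecture.FinalStateConjecture.Theorems.PhaseMixingCaptureBulkKerrCaptureC2ReflectionKerrSchild
import Literature.Geometry.Lorentzian.ExtensionProofs
import HarnessLib

/-!
# `CaptureSufficesTame` (stmt-FinalStateConjecture-17270), line `only-the-third-law-is-generic`, stub
# `stub_noC0_reduction`: the registered sub-goal NoC0KerrChart REDUCES to the rest-frame Main Lemma

The model-point rigidity statement NoC0KerrChart (hypothesis `h` of
`stub_labelRigidityC0_minkowski_of_noC0KerrChart`, registered as `stub_noC0KerrChartIntoMinkowski`): no boosted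
Kerr exterior `(Λ, c, M, a)`, `0 < M`, `|a| ≤ M`, carries a late chart `Ψ` into Minkowski space whose truncated
`C⁰` deviations tend to `0` for every radius. This file is the pure bookkeeping which reduces it to the lead's
single-`ε₀` MAIN LEMMA in plain rest-frame coordinates on `E4` with `0 ≤ a ≤ M`:

* `exists_forall_enorm_deviation_le` (ModelPoint file): convergence of the truncated `C⁰` deviations for the
  radius `R` gives a late time `T₀` after which `‖(Ψ^* η − g_{Λ,c,M,a})(x)‖ ≤ ε'` on the fat region
  `{T₀ ≤ t*, r ≤ R}`;
* `noC0Red_exists_spinIsometry`: the spin sign is normalised by the coordinate reflection `x₂ ↦ −x₂`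
  (`bilin_reflect`: `g_{M,−a}(x)(v, w) = g_{M,a}(Lx)(Lv, Lw)`), the identity if `0 ≤ a`;
* `noC0Red_exists_restFrameChart`: the rest-frame chunk `Ω = {r₊ < r < R, −T < t* < T}` (parameters `M, |a|`) is
  moved into that fat late region by `A y = Λ L (y + s ∂₀) + c` (time shift `s = max T₀ τ₀ + T + 1`,
  stationarity `Kerr.bilin_add_smul_basisVector_zero`), and `Φ = Ψ ∘ A` is a smooth injective map on `Ω` with
  `Φ^* η − g_{M,|a|} = (Ψ^* η − g_{Λ,c,M,a})(A ·)[ΛL ·, ΛL ·]`, whence `‖Φ^* η − g_{M,|a|}‖ ≤ ‖Λ‖² ε'` on `Ω`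
  (chart calculus on `Opens E4`: `OpensChart.contMDiffAt_iff`, `OpensChart.mfderiv_eq`; operator-norm bound
  `C0Extension.norm_bilinearComp_le`);
* `stub_noC0_reduction`: with `ε' = ε₀ / (‖Λ‖² + 1)` this contradicts the Main Lemma.

## References
* M. Dafermos, G. Holzegel, I. Rodnianski, M. Taylor, arXiv:2104.08222, §1 (near-zone `C⁰` closeness).
  [arXiv210408222]
* R. P. Kerr, A. Schild, 1965, §2–§3 (Lorentz covariance / stationarity of the Kerr–Schild form). [KerrSchild1965]
-/

-- the doubled `FinalStateConjecture.FinalStateConjecture` path component trips dupNamespace (as in the skeleton)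
set_option linter.dupNamespace false
set_option maxSynthPendingDepth 3

noncomputable section

open Set Filter Function Bundle Metric
open scoped Manifold ContDiff Topology ENNReal

namespace Summit.FinalStateConjecture.FinalStateConjecture.Theorems.PhaseMixingCaptureCaptureSufficesTame

open Literature.Geometry.Lorentzian
open Summit.FinalStateConjecture.FinalStateConjecture.Theorems.BulkKerrCaptureC2.Reflection (exists_reflections
  radius_reflect reflect_apply_zero bilin_reflect)
open Summit.FinalStateConjecture.FinalStateConjecture.Theorems.ZeroEnergyRigidity.Negative (radius_neg)

/-! ## Spin-sign normalisation -/

/-- **Spin-sign normalisation.** For every spin `a` there is a Euclidean linear isometry `L` of `ℝ⁴` — the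
identity if `0 ≤ a`, the reflection `x₂ ↦ −x₂` if `a < 0` — with `g_{M,|a|}(x)(v, w) = g_{M,a}(Lx)(Lv, Lw)`,
`r(a, Lx) = r(|a|, x)` and `(Lx)⁰ = x⁰` (spin reversal is an isometry of the Kerr–Schild family).
[cite: KerrSchild1965, §2] -/
theorem noC0Red_exists_spinIsometry (M a : ℝ) : ∃ L : E4 ≃ₗᵢ[ℝ] E4,
    (∀ x v w : E4, Kerr.bilin M |a| x v w = Kerr.bilin M a (L x) (L v) (L w)) ∧
    (∀ x : E4, Kerr.radius a (L x) = Kerr.radius |a| x) ∧ (∀ x : E4, L x 0 = x 0) := by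
  rcases le_or_gt 0 a with ha | ha
  · refine ⟨LinearIsometryEquiv.refl ℝ E4, fun x v w ↦ ?_, fun x ↦ ?_, fun x ↦ rfl⟩
    · rw [abs_of_nonneg ha]; rfl
    · rw [abs_of_nonneg ha]; rfl
  · obtain ⟨L, L₃, hL, -⟩ := exists_reflections
    refine ⟨L, fun x v w ↦ ?_, fun x ↦ ?_, reflect_apply_zero hL⟩
    · rw [abs_of_neg ha]
      exact bilin_reflect hL M a x v w
    · rw [abs_of_neg ha, radius_reflect hL, radius_neg]

/-! ## Transplanting a late chart of a boosted Kerr background to the rest-frame chunk -/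

/-- **Rest-frame transplant of a late chart.** Let `Ψ` be a late chart (after `τ₀`) of the boosted Kerr background
`(Λ, c, M, a)`, `0 < M`, into Minkowski space with `‖(Ψ^* η − g_{Λ,c,M,a})(x)‖ ≤ ε` at every `x` of the fat late
region `{T₀ ≤ t*, r ≤ R}`. Then on the rest-frame chunk `Ω = {r₊(M,|a|) < r(|a|,·) < R, −T < x⁰ < T}` the map
`Φ = Ψ(Λ L(· + s ∂₀) + c)` (`L` the spin-normalising isometry, `s = max T₀ τ₀ + T + 1`) is smooth and injective
with `‖Φ^* η − g_{M,|a|}‖ ≤ ‖Λ‖² ε` on `Ω`. [cite: arXiv210408222, §1] -/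
theorem noC0Red_exists_restFrameChart (Λ : lorentzGroup) (c : E4) {M : ℝ} (a : ℝ) (hM : 0 < M) {τ₀ : ℝ}
    (Ψ : (boostedKerrBackground Λ c M a).domain → Minkowski.spacetime.carrier)
    (hΨ : Minkowski.spacetime.IsLateChart (boostedKerrBackground Λ c M a) univ τ₀ Ψ) {R T T₀ ε : ℝ}
    (hdev : ∀ x : (boostedKerrBackground Λ c M a).domain,
      T₀ ≤ (boostedKerrBackground Λ c M a).time x.1 → (boostedKerrBackground Λ c M a).radius x.1 ≤ R →
        ‖Minkowski.spacetime.deviation (boostedKerrBackground Λ c M a) Ψ x‖ ≤ ε) :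
    ∃ Φ : E4 → E4,
      ContDiffOn ℝ ∞ Φ {x : E4 | Kerr.rPlus M |a| < Kerr.radius |a| x ∧ Kerr.radius |a| x < R ∧
        -T < x 0 ∧ x 0 < T} ∧
      InjOn Φ {x : E4 | Kerr.rPlus M |a| < Kerr.radius |a| x ∧ Kerr.radius |a| x < R ∧
        -T < x 0 ∧ x 0 < T} ∧
      ∀ x : E4, (Kerr.rPlus M |a| < Kerr.radius |a| x ∧ Kerr.radius |a| x < R ∧ -T < x 0 ∧ x 0 < T) →
        ‖MetricCoord.pullMetric (fun _ ↦ Minkowski.bilin) Φ x - Kerr.bilin M |a| x‖ ≤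
          ‖((Λ : E4 ≃L[ℝ] E4) : E4 →L[ℝ] E4)‖ ^ 2 * ε := by
  obtain ⟨L, hLb, hLr, hL0⟩ := noC0Red_exists_spinIsometry M a
  -- the linear part `Λ ∘ L` of the motion, the time shift `s`, the affine map `A`
  obtain ⟨Tl, hTl⟩ : ∃ Tl : E4 →L[ℝ] E4, Tl = ((Λ : E4 ≃L[ℝ] E4) : E4 →L[ℝ] E4).comp
      (L.toContinuousLinearEquiv : E4 →L[ℝ] E4) := ⟨_, rfl⟩
  have hTl_apply : ∀ v : E4, Tl v = (Λ : E4 ≃L[ℝ] E4) (L v) := fun v ↦ by rw [hTl]; rfl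
  have hTl_inj : Injective Tl := fun v₁ v₂ h ↦ by
    rw [hTl_apply, hTl_apply] at h
    exact L.injective ((Λ : E4 ≃L[ℝ] E4).injective h)
  have hTl_norm : ‖Tl‖ ≤ ‖((Λ : E4 ≃L[ℝ] E4) : E4 →L[ℝ] E4)‖ := by
    have hL1 : ‖(L.toContinuousLinearEquiv : E4 →L[ℝ] E4)‖ ≤ 1 :=
      ContinuousLinearMap.opNorm_le_bound _ zero_le_one fun v ↦ by
        rw [one_mul]
        exact (L.norm_map v).le
    rw [hTl]
    refine (ContinuousLinearMap.opNorm_comp_le _ _).trans ?_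
    calc _ ≤ ‖((Λ : E4 ≃L[ℝ] E4) : E4 →L[ℝ] E4)‖ * 1 := by gcongr
      _ = _ := mul_one _
  set s : ℝ := max T₀ τ₀ + T + 1 with hs
  obtain ⟨A, hA⟩ : ∃ A : E4 → E4, A = fun y ↦ Tl (y + s • E4.basisVector 0) + c := ⟨_, rfl⟩
  have hA_apply : ∀ y : E4, A y = Tl (y + s • E4.basisVector 0) + c := fun y ↦ by rw [hA]
  have hA_inv : ∀ y : E4, poincareInv Λ c (A y) = L (y + s • E4.basisVector 0) := fun y ↦ by
    rw [hA_apply, hTl_apply, poincareInv, add_sub_cancel_right, ContinuousLinearEquiv.symm_apply_apply]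
  have hA_time : ∀ y : E4, (boostedKerrBackground Λ c M a).time (A y) = y 0 + s := fun y ↦ by
    show poincareInv Λ c (A y) 0 = y 0 + s
    rw [hA_inv, hL0]
    simp
  have hA_rad : ∀ y : E4, (boostedKerrBackground Λ c M a).radius (A y) = Kerr.radius |a| y := fun y ↦ by
    show Kerr.radius a (poincareInv Λ c (A y)) = Kerr.radius |a| y
    rw [hA_inv, hLr, Kerr.radius_add_time_smul_basisVector]
  have hrPlus : Kerr.rPlus M |a| = Kerr.rPlus M a := by unfold Kerr.rPlus; rw [sq_abs]
  have hrPlus0 : 0 ≤ Kerr.rPlus M a := by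
    unfold Kerr.rPlus
    linarith [Real.sqrt_nonneg (M ^ 2 - a ^ 2)]
  have hA_mem : ∀ y : E4, Kerr.rPlus M |a| < Kerr.radius |a| y → A y ∈ boostedKerrExterior Λ c M a := by
    intro y hy
    rw [mem_boostedKerrExterior, Kerr.mem_exterior, hA_inv, hLr, Kerr.radius_add_time_smul_basisVector]
    rw [hrPlus] at hy
    exact max_lt hy (hrPlus0.trans_lt hy)
  have hA_diff : ∀ y : E4, HasFDerivAt A Tl y := fun y ↦ by
    rw [hA]
    have h := ((Tl.hasFDerivAt (x := y + s • E4.basisVector 0)).comp y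
      ((hasFDerivAt_id y).add_const (s • E4.basisVector 0))).add_const c
    rwa [ContinuousLinearMap.comp_id] at h
  have hA_contDiff : ContDiff ℝ ∞ A := by
    rw [hA]
    exact (Tl.contDiff.comp (contDiff_id.add contDiff_const)).add contDiff_const
  -- a coordinate representative `Ψe : E4 → E4` of the chart and its calculus
  set Ψ' : (boostedKerrBackground Λ c M a).domain → E4 := Ψ with hΨ'
  set Ψe : E4 → E4 := Function.extend Subtype.val Ψ' 0 with hΨe
  have hrep : ∀ z : (boostedKerrBackground Λ c M a).domain, Ψ' z = Ψe z := fun z ↦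
    (Subtype.val_injective.extend_apply _ _ z).symm
  have hsmooth : ∀ z : (boostedKerrBackground Λ c M a).domain, ContDiffAt ℝ ∞ Ψe z := fun z ↦ by
    have h2 : ContMDiffAt 𝓘(ℝ, E4) 𝓘(ℝ, E4) ∞ Ψ' z := hΨ.contMDiff z
    exact (OpensChart.contMDiffAt_iff z Ψ' Ψe hrep).1 h2
  have hmf : ∀ z : (boostedKerrBackground Λ c M a).domain,
      mfderiv 𝓘(ℝ, E4) (𝓡 4) Ψ z = fderiv ℝ Ψe z := fun z ↦ by
    have h3 : mfderiv 𝓘(ℝ, E4) 𝓘(ℝ, E4) Ψ' z = fderiv ℝ Ψe z :=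
      OpensChart.mfderiv_eq z Ψ' Ψe hrep ((hsmooth z).differentiableAt (by simp))
    exact h3
  have hdev_apply : ∀ (z : (boostedKerrBackground Λ c M a).domain) (v w : E4),
      Minkowski.spacetime.deviation (boostedKerrBackground Λ c M a) Ψ z v w =
        Minkowski.bilin (fderiv ℝ Ψe z v) (fderiv ℝ Ψe z w) -
          Kerr.bilin M a (poincareInv Λ c z) ((Λ : E4 ≃L[ℝ] E4).symm v) ((Λ : E4 ≃L[ℝ] E4).symm w) := by
    intro z v w
    rw [Spacetime.deviation_apply, hmf z]
    rfl
  -- the transplanted chart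
  obtain ⟨Φ, hΦ⟩ : ∃ Φ : E4 → E4, Φ = fun y ↦ Ψe (A y) := ⟨_, rfl⟩
  have hΦ_fderiv : ∀ y : E4, Kerr.rPlus M |a| < Kerr.radius |a| y →
      fderiv ℝ Φ y = (fderiv ℝ Ψe (A y)).comp Tl := by
    intro y hy
    have h1 : DifferentiableAt ℝ Ψe (A y) :=
      (hsmooth ⟨A y, hA_mem y hy⟩).differentiableAt (by simp)
    rw [hΦ]
    exact (h1.hasFDerivAt.comp y (hA_diff y)).fderiv
  -- the deviation identity `Φ^* η − g_{M,|a|} = (Ψ^* η − g_{Λ,c,M,a})(A ·)[Tl ·, Tl ·]`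
  have hpull : ∀ (y : E4) (hy : Kerr.rPlus M |a| < Kerr.radius |a| y),
      MetricCoord.pullMetric (fun _ ↦ Minkowski.bilin) Φ y - Kerr.bilin M |a| y =
        (Minkowski.spacetime.deviation (boostedKerrBackground Λ c M a) Ψ ⟨A y, hA_mem y hy⟩).bilinearComp
          Tl Tl := by
    intro y hy
    refine ContinuousLinearMap.ext fun v ↦ ContinuousLinearMap.ext fun w ↦ ?_
    rw [ContinuousLinearMap.bilinearComp_apply, hdev_apply, sub_apply, sub_apply,
      MetricCoord.pullMetric_apply, hΦ_fderiv y hy, ContinuousLinearMap.coe_comp, Function.comp_apply,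
      Function.comp_apply]
    have h2 : poincareInv Λ c (⟨A y, hA_mem y hy⟩ : (boostedKerrBackground Λ c M a).domain) =
        L (y + s • E4.basisVector 0) := hA_inv y
    rw [h2, hTl_apply, hTl_apply, ContinuousLinearEquiv.symm_apply_apply,
      ContinuousLinearEquiv.symm_apply_apply, ← hLb, Kerr.bilin_add_smul_basisVector_zero]
  refine ⟨Φ, fun y hy ↦ ?_, fun y₁ h₁ y₂ h₂ heq ↦ ?_, fun y hy ↦ ?_⟩
  · -- smoothness on `Ω`
    have h1 : ContDiffAt ℝ ∞ Ψe (A y) := hsmooth ⟨A y, hA_mem y hy.1⟩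
    rw [hΦ]
    exact (h1.comp y hA_contDiff.contDiffAt).contDiffWithinAt
  · -- injectivity on `Ω`: `A` is injective with values in the late region, where `Ψ` is injective
    have hlate : ∀ y : E4, -T < y 0 → τ₀ < (boostedKerrBackground Λ c M a).time (A y) := fun y hy ↦ by
      rw [hA_time, hs]
      linarith [le_max_right T₀ τ₀]
    have key : (⟨⟨A y₁, hA_mem y₁ h₁.1⟩, hlate y₁ h₁.2.2.1⟩ : (boostedKerrBackground Λ c M a).lateRegion τ₀) =
        ⟨⟨A y₂, hA_mem y₂ h₂.1⟩, hlate y₂ h₂.2.2.1⟩ := by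
      refine hΨ.isOpenEmbedding.injective ?_
      show Ψ' ⟨A y₁, hA_mem y₁ h₁.1⟩ = Ψ' ⟨A y₂, hA_mem y₂ h₂.1⟩
      rw [hrep, hrep]
      simpa [hΦ] using heq
    have hAeq : A y₁ = A y₂ := congrArg
      (fun z : (boostedKerrBackground Λ c M a).lateRegion τ₀ ↦ ((z : (boostedKerrBackground Λ c M a).domain) : E4))
      key
    rw [hA_apply, hA_apply, add_left_inj] at hAeq
    exact add_right_cancel (hTl_inj hAeq)
  · -- the norm bound on `Ω`
    have htime : T₀ ≤ (boostedKerrBackground Λ c M a).time (A y) := by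
      rw [hA_time, hs]
      linarith [le_max_left T₀ τ₀, hy.2.2.1]
    have hrad : (boostedKerrBackground Λ c M a).radius (A y) ≤ R := by
      rw [hA_rad]
      exact hy.2.1.le
    have hd := hdev ⟨A y, hA_mem y hy.1⟩ htime hrad
    have h0 : 0 ≤ ε := (norm_nonneg _).trans hd
    rw [hpull y hy.1]
    calc _ ≤ ‖Minkowski.spacetime.deviation (boostedKerrBackground Λ c M a) Ψ ⟨A y, hA_mem y hy.1⟩‖ *
          ‖Tl‖ * ‖Tl‖ := C0Extension.norm_bilinearComp_le _ _
      _ ≤ ε * ‖((Λ : E4 ≃L[ℝ] E4) : E4 →L[ℝ] E4)‖ * ‖((Λ : E4 ≃L[ℝ] E4) : E4 →L[ℝ] E4)‖ :=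
          mul_le_mul (mul_le_mul hd hTl_norm (norm_nonneg _) h0) hTl_norm (norm_nonneg _)
            (mul_nonneg h0 (norm_nonneg _))
      _ = _ := by ring

/-! ## The reduction -/

/-- **Registered stub `stub_noC0_reduction`** (crux item stmt-FinalStateConjecture-17270, line
`only-the-third-law-is-generic`): the rest-frame single-`ε₀` Main Lemma (no smooth injective `Φ` on the chunk
`{r₊ < r < R, −T < x⁰ < T}` of the Kerr exterior `0 ≤ a ≤ M` has `‖Φ^* η − g_{M,a}‖ ≤ ε₀` throughout) implies
the registered sub-goal NoC0KerrChart: no boosted Kerr exterior `(Λ, c, M, a)`, `0 < M`, `|a| ≤ M`, carries a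
late chart into Minkowski space whose truncated `C⁰` deviations tend to `0` for every radius (spin sign by
reflection, motion by the Poincaré map, lateness by a time shift, `ε' = ε₀ / (‖Λ‖² + 1)`).
[cite: arXiv210408222, §1] -/
theorem stub_noC0_reduction :
    (∀ (M a : ℝ), 0 < M → 0 ≤ a → a ≤ M → ∃ (R T ε₀ : ℝ), 0 < ε₀ ∧ ∀ Φ : E4 → E4,
      ContDiffOn ℝ ∞ Φ {x : E4 | Kerr.rPlus M a < Kerr.radius a x ∧ Kerr.radius a x < R ∧ -T < x 0 ∧ x 0 < T} →
      InjOn Φ {x : E4 | Kerr.rPlus M a < Kerr.radius a x ∧ Kerr.radius a x < R ∧ -T < x 0 ∧ x 0 < T} →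
      ∃ x : E4, (Kerr.rPlus M a < Kerr.radius a x ∧ Kerr.radius a x < R ∧ -T < x 0 ∧ x 0 < T) ∧
        ε₀ < ‖MetricCoord.pullMetric (fun _ ↦ Minkowski.bilin) Φ x - Kerr.bilin M a x‖) →
    ∀ (Λ : lorentzGroup) (c : E4) (M a τ₀ : ℝ), 0 < M → |a| ≤ M →
      ∀ Ψ : (boostedKerrBackground Λ c M a).domain → Minkowski.spacetime.carrier,
        Minkowski.spacetime.IsLateChart (boostedKerrBackground Λ c M a) univ τ₀ Ψ →
        ¬ ∀ R : ℝ, Tendsto (fun τ ↦ Minkowski.spacetime.truncDeviationCk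
            (boostedKerrBackground Λ c M a) Ψ 0 R τ) atTop (𝓝 0) := by
  intro hML Λ c M a τ₀ hM haM Ψ hΨ hlim
  obtain ⟨R, T, ε₀, hε₀, hmain⟩ := hML M |a| hM (abs_nonneg a) haM
  set C : ℝ := ‖((Λ : E4 ≃L[ℝ] E4) : E4 →L[ℝ] E4)‖ ^ 2 with hC
  have hC0 : 0 ≤ C := by positivity
  set ε' : ℝ := ε₀ / (C + 1) with hε'
  have hε'0 : 0 < ε' := div_pos hε₀ (by linarith)
  have hev : ∀ᶠ τ in atTop, Minkowski.spacetime.truncDeviationCk (boostedKerrBackground Λ c M a) Ψ 0 R τ ≤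
      ENNReal.ofReal ε' :=
    (hlim R).eventually (ge_mem_nhds (ENNReal.ofReal_pos.2 hε'0))
  obtain ⟨T₀, hT₀⟩ := exists_forall_enorm_deviation_le Minkowski.spacetime _ Ψ hev
  have hdev : ∀ x : (boostedKerrBackground Λ c M a).domain,
      T₀ ≤ (boostedKerrBackground Λ c M a).time x.1 → (boostedKerrBackground Λ c M a).radius x.1 ≤ R →
        ‖Minkowski.spacetime.deviation (boostedKerrBackground Λ c M a) Ψ x‖ ≤ ε' := by
    intro x h1 h2
    have h := hT₀ x h1 h2
    rw [← ofReal_norm] at h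
    exact (ENNReal.ofReal_le_ofReal_iff hε'0.le).1 h
  obtain ⟨Φ, hΦs, hΦi, hΦb⟩ := noC0Red_exists_restFrameChart Λ c a hM Ψ hΨ (T := T) hdev
  obtain ⟨x, hx, hlt⟩ := hmain Φ hΦs hΦi
  have hb := hΦb x hx
  have hCε : C * ε' ≤ ε₀ := by
    rw [hε', mul_div_assoc', div_le_iff₀ (by linarith)]
    nlinarith
  linarith

end Summit.FinalStateConjecture.FinalStateConjecture.Theorems.PhaseMixingCaptureCaptureSufficesTame

end
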